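import Literature.Computability.MetaComplexity.LowDegreeTwoModuliExpSums
import Literature.Barriers.QuantumAdvantage.NonclassicalDegreeLogBarrier
import HarnessLib

/-!
# `MOD_m` characters versus classical low-degree `𝔽₂`-polynomials: the Viola–Wigderson bound
# `exp(−Ω(n/4^d))` in the tree's `degLE` vocabulary (classical ⇒ nonclassical bridge)

**Source.** E. Viola, A. Wigderson, *Norms, XOR lemmas, and lower bounds for polynomials and
protocols*, Theory of Computing 4 (2008) 137–168 [ViolaWigderson2008]:
"**Theorem 2.9.** For any odd `m`, `Cor_Q(Mod_m, P_d) ≤ exp(−α·n/4^d)`, where `α = α(m) > 0`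
depends on `m` only" (p. 149); the character estimate in its proof (pp. 149–150, via Lemma 2.3
= Gowers–Cauchy–Schwarz and Fact 2.7 = product rule): for a degree-`d` polynomial
`p : {0,1}ⁿ → {−1,1}` over GF(2) and `a ∈ {1,…,m−1}`,
`|E_x e_m(aΣ_j x_j)·p(x)| ≤ U_{d+1}(e_m^a)^{n/2^{d+1}}`, `U_k(e_m^a) = 1 − (1 − δ)/2^k`,
`δ = Re e_m(a2^{k−1}) < 1` — i.e. `exp(−Ω(n/4^d))`; history (p. 145): Bourgain 2005
[Bourgain2005ExpSums] `exp(−Ω(n/8^d))`-type, Green–Roy–Straubing 2005 [GreenRoyStraubing2005,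
Thm 1.1] (all coprime `(m,q)`; in the tree: `TwoModuli.norm_sum_le_grsMu_pow`, exponent
`(q2^q)^{d−1}`), "the techniques of [Bourgain, GRS, Chattopadhyay] generalize to polynomials
modulo `q` … while our methods appear to be limited to `q = 2`".

**What the tree already had.** The degree-norm argument is carried out in
`Literature/Barriers/QuantumAdvantage/NonclassicalDegreeLogBarrier.lean` for NONCLASSICAL phases:
`NonclassicalPolynomials.bhowmickLovett_thm31` bounds `‖Σ_x e(P x)·e(a|x|/m)‖^{2^{d+1}}` for every
real lift `P : 𝔽₂^ι → ℝ` with `IsNonclassicalPoly d P` ([BhowmickLovett2015, Thm 3.1] =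
[ViolaWigderson2008, §2.3]).  The classical exponential sums of the advice-free-`QNC⁰` ladder live on
the cube `ι → Bool` with `P ∈ TwoModuli.degLE (ZMod 2) ι d` (span of the monomials `x_S`,
`|S| ≤ d`) and the characters `ZMod.stdAddChar`.

**What this file adds (all PROVED, no new facts).**
* §1 the cube bridge `toBoolVec`/`ofBoolVec`/`boolCubeEquiv` between `ι → ZMod 2` and `ι → Bool`
  (`toBoolVec_add`: addition becomes `TwoModuli.xorVec`);
* §2 the discrete `𝔽₂`-derivative `derivF h P (x) = P(x ⊕ h) − P(x)` and its iterate
  `iterDerivF`; the shift formula `cubeMono_xorVec` (`x_S(x ⊕ u) = Σ_{T ⊆ S} x_T(x)·x_{S∖T}(u)` over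
  `𝔽₂`, from `Finset.prod_add`), hence `comp_xorVec_mem_degLE` (shifts preserve degree) and the
  **degree drop** `derivF_mem_degLE` (`P ∈ degLE (d+1) ⇒ D_h P ∈ degLE d`),
  `derivF_eq_zero_of_mem_degLE_zero`, `iterDerivF_eq_zero` (`d+1` derivatives kill degree `≤ d`)
  — the classical characterisation behind [BhowmickLovett2015, Def. 2.1] /
  [ViolaWigderson2008, §2.1 ("every parity check is 1")];
* §3 the half-lift `halfLift P (y) = (P x).val / 2` of a classical `P` (so `e(halfLift P) = χ₂(P)`,
  `eChar_halfLift`), `deriv_halfLift` / `iterDeriv_halfLift` (real derivatives of the lift = lift of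
  the `𝔽₂`-derivatives modulo `ℤ`-valued functions) and the **bridge**
  `isNonclassicalPoly_halfLift : P ∈ degLE (ZMod 2) ι d → IsNonclassicalPoly d (halfLift P)`
  ("classical polynomials of degree `d` are nonclassical polynomials of degree `≤ d`",
  [BhowmickLovett2015, §1]);
* §4 **Viola–Wigderson's Theorem 2.9 for classical polynomials in GRS normalisation**:
  `norm_sum_pow_le_of_mem_degLE` — for `m` odd, `a ≠ 0` in `ℤ/m`, `P ∈ degLE (ZMod 2) ι d`,
  `‖Σ_{x ∈ {0,1}^ι} χ₂(P x)·χ_m(a)^{#x}‖^{2^{d+1}} ≤ (1 − (1 − cos(2π/m))/2^{d+1})ⁿ·(2ⁿ)^{2^{d+1}}` —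
  and the exponential form `norm_sum_le_two_pow_mul_exp`:
  `‖Σ‖ ≤ 2ⁿ·exp(−(1 − cos(2π/m))·n/4^{d+1})`; for `m = 3`: `2ⁿ·exp(−3n/(8·4^d))`
  (`norm_sum_le_two_pow_mul_exp_three`);
* §5 restriction to a sub-cube preserves degree (`restrict_mem_degLE`), juntas have degree at most
  their arity (`mem_degLE_card_of_forall_eq`), and the **arbitrary-linear-form version for
  `m = 3`**: `norm_sum_mul_stdAddChar_linear_le` — for every `γ : ι → ℤ/3`,
  `‖Σ_{x ∈ {0,1}^ι} χ₂(P x)·χ₃(Σ_i γ_i x_i)‖ ≤ 2ⁿ·exp(−3·wt(γ)/(8·4^d))`, `wt(γ) = #{i : γ_i ≠ 0}`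
  (coordinate flips on `{γ_i = 2}`, restriction to `supp γ`, fibre sum);
* §6 the same estimates in the **`ω^k · (−1)^g` shape** used by the advice-free-`QNC⁰` cell (cube
  `Fin n → Bool`, `g ∈ Smolensky.lowDeg (ZMod 2) n d`, phase `exp(2πi/3)^{Σ_{i : x_i} (a_i).val}`, sign
  `if g x = 1 then −1 else 1`): the dictionary `cexp_two_pi_I_div_three_pow`,
  `cexp_pow_sum_val_eq_stdAddChar`, `ite_eq_one_eq_stdAddChar`; `norm_sum_cexp_pow_mul_sign_le`
  (`≤ 2ⁿ·exp(−3·wt(a)/(8·4^d))`), `norm_sum_cexp_pow_mul_sign_le_of_forall_ne_zero` (full support: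
  `≤ 2ⁿ·exp(−(3/(8·4^d))·n)`), the packaged `mod3VsLowDegree`
  (`∀ d ∃ c > 0 ∃ n₀ ∀ n ≥ n₀ …`, witnesses `c = 3/(8·4^d)`, `n₀ = 0`); and the **sharp linear case**
  (character versus a product of signs, the `d = 1` factorisation of [GreenRoyStraubing2005, §2] /
  [Bourgain2005ExpSums, (10)] with coordinate-dependent coefficients):
  `norm_sum_stdAddChar_linear_mul_prod_sign_le`
  (`‖Σ_F χ₃(Σ_{i : F_i} γ_i)·∏_{i : F_i ∧ s_i}(−1)‖ ≤ 2^{|ι|}(√3/2)^{wt γ}`, from `‖1 ± χ₃(γ)‖ ≤ 2cos(π/6)`)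
  and its cell shape `charVsProduct` (`ι = Fin q`, phase `ω^{Σ (γ_p).val}`).

Deliberately NOT here: the correlation form under the non-uniform distribution `Q` of
[ViolaWigderson2008, §2.3] (Lemma 2.10) and the Boolean `Mod_m` function; `𝔽_q`, `q ≠ 2`, inputs
(that is [GreenRoyStraubing2005] = `LowDegreeTwoModuliExpSums`); general moduli `m` in §5 (for
`m = 3` every nonzero coefficient is `±1`, so flips suffice — TODO(general form): distinct unit
coefficients need the product rule `uPow_prodFn` with a coordinate-dependent parameter).

## References
* [ViolaWigderson2008] E. Viola, A. Wigderson, Theory of Computing 4 (2008) 137–168: Def. 2.2 &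
  Lemma 2.3 (p. 146), Fact 2.7, Thm 2.9 (p. 149) and its proof (pp. 149–150), §1.2.4 (p. 145).
* [BhowmickLovett2015] A. Bhowmick, S. Lovett, CCC 2015 (LIPIcs 33) 72–87, Def. 2.1, Thm 3.1.
* [GreenRoyStraubing2005] F. Green, A. Roy, H. Straubing, C. R. Acad. Sci. Paris 341 (2005)
  279–282, Thm 1.1.
* [Bourgain2005ExpSums] J. Bourgain, C. R. Acad. Sci. Paris 340 (2005) 627–631.
-/

noncomputable section

open Finset Complex ZMod

namespace Literature.Computability.MetaComplexity

namespace TwoModuli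

open Literature.Barriers.QuantumAdvantage
open Literature.Barriers.QuantumAdvantage.NonclassicalPolynomials (iterDeriv IsIntValued
  IsNonclassicalPoly weight eChar iterDeriv_cons iterDeriv_nil iterDeriv_add eChar_add eChar_intCast
  eChar_nat_mul bhowmickLovett_thm31)

/-! ### 1. The two cubes `ι → ZMod 2` and `ι → Bool` -/

section Cube

variable {ι : Type*}

/-- `𝔽₂ = {0, 1}`. [folklore] -/
private theorem zmod_two_cases (u : ZMod 2) : u = 0 ∨ u = 1 := by
  fin_cases u
  · exact Or.inl rfl
  · exact Or.inr rfl

/-- The `{0,1}`-vector of an `𝔽₂`-vector (`true ↔ 1`).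
[cite: ViolaWigderson2008, §2 ("a polynomial over GF(2) as a function from {0,1}ⁿ")] -/
def toBoolVec (y : ι → ZMod 2) : ι → Bool := fun i => decide (y i = 1)

/-- The `𝔽₂`-vector of a `{0,1}`-vector (`true ↦ 1`).
[cite: ViolaWigderson2008, §2 ("a polynomial over GF(2) as a function from {0,1}ⁿ")] -/
def ofBoolVec (x : ι → Bool) : ι → ZMod 2 := fun i => if x i then 1 else 0

/-- Unfolding. [cite: ViolaWigderson2008, §2] -/
@[simp] theorem toBoolVec_apply (y : ι → ZMod 2) (i : ι) : toBoolVec y i = decide (y i = 1) := rfl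

/-- Unfolding. [cite: ViolaWigderson2008, §2] -/
@[simp] theorem ofBoolVec_apply (x : ι → Bool) (i : ι) :
    ofBoolVec x i = if x i then (1 : ZMod 2) else 0 := rfl

/-- Round trip. [cite: ViolaWigderson2008, §2] -/
@[simp] theorem toBoolVec_ofBoolVec (x : ι → Bool) : toBoolVec (ofBoolVec x) = x := by
  funext i
  cases h : x i <;> simp [h]

/-- Round trip. [cite: ViolaWigderson2008, §2] -/
@[simp] theorem ofBoolVec_toBoolVec (y : ι → ZMod 2) : ofBoolVec (toBoolVec y) = y := by
  funext i
  rcases zmod_two_cases (y i) with h | h <;> simp [h]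

/-- The two cubes are in bijection. [cite: ViolaWigderson2008, §2] -/
def boolCubeEquiv : (ι → Bool) ≃ (ι → ZMod 2) where
  toFun := ofBoolVec
  invFun := toBoolVec
  left_inv := toBoolVec_ofBoolVec
  right_inv := ofBoolVec_toBoolVec

/-- Unfolding. [cite: ViolaWigderson2008, §2] -/
@[simp] theorem boolCubeEquiv_apply (x : ι → Bool) : boolCubeEquiv x = ofBoolVec x := rfl

/-- On `𝔽₂`, `[a + b = 1] = [a = 1] ⊕ [b = 1]`. [folklore] -/
private theorem decide_add_eq_one (a b : ZMod 2) :
    decide (a + b = 1) = xor (decide (a = 1)) (decide (b = 1)) := by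
  revert a b
  decide

/-- Addition in `𝔽₂^ι` is the componentwise XOR `⊕` of `{0,1}^ι`.
[cite: ViolaWigderson2008, Def. 2.2 ("⊕ denotes bitwise xor")] -/
theorem toBoolVec_add (y h : ι → ZMod 2) : toBoolVec (y + h) = xorVec (toBoolVec y) (toBoolVec h) := by
  funext i
  exact decide_add_eq_one (y i) (h i)

/-- The weight `|y| = #{i : y_i = 1}` is the number of `true` coordinates.
[cite: ViolaWigderson2008, §2.3 (Σ_i x_i)] -/
theorem weight_ofBoolVec [Fintype ι] (x : ι → Bool) :
    weight (ofBoolVec x) = (univ.filter fun i => x i = true).card := by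
  unfold weight
  congr 1
  refine filter_congr fun i _ => ?_
  cases h : x i <;> simp [h]

end Cube

/-! ### 2. The discrete `𝔽₂`-derivative on `{0,1}^ι` and the degree drop -/

section DerivF

variable {ι : Type*}

/-- The discrete derivative `D_h P (x) = P(x ⊕ h) − P(x)` of an `𝔽₂`-valued function on the cube.
[cite: BhowmickLovett2015, Def. 2.1 (D_h f(x) = f(x + h) − f(x))] -/
def derivF (h : ι → Bool) (P : (ι → Bool) → ZMod 2) : (ι → Bool) → ZMod 2 :=
  fun x => P (xorVec x h) - P x

/-- Iterated discrete derivative (head applied first).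
[cite: BhowmickLovett2015, Def. 2.1 (D_{h₁} ⋯ D_{h_{d+1}} f)] -/
def iterDerivF : List (ι → Bool) → ((ι → Bool) → ZMod 2) → (ι → Bool) → ZMod 2
  | [], P => P
  | h :: hs, P => iterDerivF hs (derivF h P)

/-- Unfolding. [cite: BhowmickLovett2015, Def. 2.1] -/
@[simp] theorem derivF_apply (h : ι → Bool) (P : (ι → Bool) → ZMod 2) (x : ι → Bool) :
    derivF h P x = P (xorVec x h) - P x := rfl

/-- No derivative. [cite: BhowmickLovett2015, Def. 2.1] -/
@[simp] theorem iterDerivF_nil (P : (ι → Bool) → ZMod 2) : iterDerivF [] P = P := rfl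

/-- One more derivative. [cite: BhowmickLovett2015, Def. 2.1] -/
@[simp] theorem iterDerivF_cons (h : ι → Bool) (hs : List (ι → Bool)) (P : (ι → Bool) → ZMod 2) :
    iterDerivF (h :: hs) P = iterDerivF hs (derivF h P) := rfl

/-- `D_h` of a finite linear combination. [cite: BhowmickLovett2015, §2 (D_h is additive)] -/
theorem derivF_sum_smul {κ : Type*} (s : Finset κ) (c : κ → ZMod 2)
    (Q : κ → (ι → Bool) → ZMod 2) (h : ι → Bool) :
    derivF h (∑ k ∈ s, c k • Q k) = ∑ k ∈ s, c k • derivF h (Q k) := by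
  funext x
  simp only [derivF_apply, Finset.sum_apply, Pi.smul_apply, smul_eq_mul, mul_sub, sum_sub_distrib]

/-- Over `𝔽₂` the indicator of `a ⊕ b` is the sum of the indicators. [folklore] -/
private theorem ite_xor_eq_add (a b : Bool) :
    (if xor a b then (1 : ZMod 2) else 0) = (if a then (1 : ZMod 2) else 0) + (if b then 1 else 0) := by
  cases a <;> cases b <;> decide

/-- **Shift formula over `𝔽₂`**: `x_S(x ⊕ u) = Σ_{T ⊆ S} x_T(x)·x_{S∖T}(u)` (expand
`Π_{i∈S}([x_i] + [u_i])`). [cite: ViolaWigderson2008, Def. 2.2 (parity checks of the Reed–Muller code)] -/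
theorem cubeMono_xorVec [DecidableEq ι] (S : Finset ι) (x u : ι → Bool) :
    cubeMono (ZMod 2) S (xorVec x u)
      = ∑ T ∈ S.powerset, cubeMono (ZMod 2) T x * cubeMono (ZMod 2) (S \ T) u := by
  unfold cubeMono
  rw [show (∏ i ∈ S, if xorVec x u i then (1 : ZMod 2) else 0)
      = ∏ i ∈ S, ((if x i then (1 : ZMod 2) else 0) + (if u i then 1 else 0)) from
    prod_congr rfl fun i _ => ite_xor_eq_add (x i) (u i), prod_add]

/-- The empty monomial is `1`. [cite: GreenRoyStraubing2005, §1] -/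
@[simp] theorem cubeMono_empty_apply {R : Type*} [CommRing R] (x : ι → Bool) :
    cubeMono R ∅ x = 1 := by
  simp [cubeMono]

/-- Shifts preserve degree over `𝔽₂`: `P ∈ degLE d ⇒ (x ↦ P(x ⊕ u)) ∈ degLE d`.
[cite: GreenRoyStraubing2005, §2 ("the map x → x ⊕ u is a permutation of {0,1}ⁿ")] -/
theorem comp_xorVec_mem_degLE [Fintype ι] [DecidableEq ι] {d : ℕ} {P : (ι → Bool) → ZMod 2}
    (hP : P ∈ degLE (ZMod 2) ι d) (u : ι → Bool) :
    (fun x => P (xorVec x u)) ∈ degLE (ZMod 2) ι d := by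
  obtain ⟨c, rfl⟩ := mem_degLE_iff.mp hP
  have hfun : (fun x => (∑ S, c S • cubeMono (ZMod 2) S.1) (xorVec x u))
      = ∑ S : {S : Finset ι // S.card ≤ d},
          ∑ T ∈ S.1.powerset, (c S * cubeMono (ZMod 2) (S.1 \ T) u) • cubeMono (ZMod 2) T := by
    funext x
    simp only [Finset.sum_apply, Pi.smul_apply, smul_eq_mul]
    refine sum_congr rfl fun S _ => ?_
    rw [cubeMono_xorVec, mul_sum]
    refine sum_congr rfl fun T _ => ?_
    ring
  rw [hfun]
  refine Submodule.sum_mem _ fun S _ => Submodule.sum_mem _ fun T hT => ?_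
  exact Submodule.smul_mem _ _ (cubeMono_mem_degLE ((card_le_card (mem_powerset.mp hT)).trans S.2))

/-- `D_h` of a monomial: `D_h x_S = Σ_{T ⊊ S} x_{S∖T}(h)·x_T` — every term has degree `< |S|`.
[cite: BhowmickLovett2015, Def. 2.1; ViolaWigderson2008, §2.1] -/
theorem derivF_cubeMono [DecidableEq ι] (S : Finset ι) (h : ι → Bool) :
    derivF h (cubeMono (ZMod 2) S)
      = ∑ T ∈ S.powerset.erase S, cubeMono (ZMod 2) (S \ T) h • cubeMono (ZMod 2) T := by
  funext x
  rw [derivF_apply, cubeMono_xorVec, Finset.sum_apply,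
    sum_erase_eq_sub (mem_powerset.mpr (Subset.refl S))]
  simp only [Pi.smul_apply, smul_eq_mul, sdiff_self, bot_eq_empty, cubeMono_empty_apply, one_mul]
  congr 1
  exact sum_congr rfl fun T _ => mul_comm _ _

/-- **Degree drop**: a derivative lowers the degree by one.
[cite: BhowmickLovett2015, Def. 2.1 (classical polynomials of degree d); ViolaWigderson2008, §2.1] -/
theorem derivF_mem_degLE [Fintype ι] [DecidableEq ι] {d : ℕ} {P : (ι → Bool) → ZMod 2}
    (hP : P ∈ degLE (ZMod 2) ι (d + 1)) (h : ι → Bool) : derivF h P ∈ degLE (ZMod 2) ι d := by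
  obtain ⟨c, rfl⟩ := mem_degLE_iff.mp hP
  rw [show (∑ S, c S • cubeMono (ZMod 2) S.1)
      = ∑ S ∈ univ, c S • cubeMono (ZMod 2) S.1 from rfl, derivF_sum_smul]
  refine Submodule.sum_mem _ fun S _ => Submodule.smul_mem _ _ ?_
  rw [derivF_cubeMono]
  refine Submodule.sum_mem _ fun T hT => Submodule.smul_mem _ _ (cubeMono_mem_degLE ?_)
  obtain ⟨hne, hT'⟩ := mem_erase.mp hT
  have hss : T ⊂ S.1 := lt_of_le_of_ne (mem_powerset.mp hT') hne
  have := card_lt_card hss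
  have := S.2
  omega

/-- Degree `≤ 0` means constant, so every derivative vanishes.
[cite: BhowmickLovett2015, Def. 2.1] -/
theorem derivF_eq_zero_of_mem_degLE_zero [Fintype ι] [DecidableEq ι] {P : (ι → Bool) → ZMod 2}
    (hP : P ∈ degLE (ZMod 2) ι 0) (h : ι → Bool) : derivF h P = 0 := by
  obtain ⟨c, rfl⟩ := mem_degLE_iff.mp hP
  funext x
  simp only [derivF_apply, Finset.sum_apply, Pi.smul_apply, smul_eq_mul, Pi.zero_apply]
  rw [← sum_sub_distrib]
  refine sum_eq_zero fun S _ => ?_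
  have hS : S.1 = ∅ := card_eq_zero.mp (Nat.le_zero.mp S.2)
  simp [cubeMono, hS]

/-- **`d + 1` derivatives annihilate degree `≤ d`** (the classical content of
"`f` belongs to the class of polynomials of degree `k − 1` iff every parity check is 1").
[cite: ViolaWigderson2008, §2.1 (Def. 2.2, discussion); BhowmickLovett2015, Def. 2.1] -/
theorem iterDerivF_eq_zero [Fintype ι] [DecidableEq ι] :
    ∀ (d : ℕ) {P : (ι → Bool) → ZMod 2}, P ∈ degLE (ZMod 2) ι d →
      ∀ hs : List (ι → Bool), hs.length = d + 1 → iterDerivF hs P = 0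
  | 0, P, hP, hs, hlen => by
      match hs, hlen with
      | [h], _ => rw [iterDerivF_cons, iterDerivF_nil, derivF_eq_zero_of_mem_degLE_zero hP]
  | d + 1, P, hP, hs, hlen => by
      match hs, hlen with
      | h :: hs', hlen' =>
        rw [iterDerivF_cons]
        exact iterDerivF_eq_zero d (derivF_mem_degLE hP h) hs' (by simpa using hlen')

end DerivF

/-! ### 3. The half-lift of a classical polynomial is a nonclassical polynomial of the same degree -/

section HalfLift

variable {ι : Type*}

/-- The half-lift `y ↦ P(x)/2 ∈ {0, ½} ⊂ ℝ` of a classical `𝔽₂`-valued `P` (a real lift of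
`P/2 ∈ 𝕋`; `x` the `{0,1}`-vector of `y`).
[cite: BhowmickLovett2015, §1 ("classical polynomials … are a special case, f(x) = P(x)/p")] -/
def halfLift (P : (ι → Bool) → ZMod 2) : (ι → ZMod 2) → ℝ := fun y => ((P (toBoolVec y)).val : ℝ) / 2

/-- Unfolding. [cite: BhowmickLovett2015, §1] -/
@[simp] theorem halfLift_apply (P : (ι → Bool) → ZMod 2) (y : ι → ZMod 2) :
    halfLift P y = ((P (toBoolVec y)).val : ℝ) / 2 := rfl

/-- `e(P(x)/2) = (−1)^{P(x)} = χ₂(P(x))`. [cite: ViolaWigderson2008, §2 ("(−1)^{p(x)}")] -/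
theorem eChar_halfLift (P : (ι → Bool) → ZMod 2) (y : ι → ZMod 2) :
    eChar (halfLift P y) = stdAddChar (P (toBoolVec y)) := by
  rw [stdAddChar_apply, toCircle_apply, NonclassicalPolynomials.eChar, halfLift_apply]
  congr 1
  push_cast
  ring

/-- The zero function lifts to zero. [cite: BhowmickLovett2015, §1] -/
@[simp] theorem halfLift_zero : halfLift (0 : (ι → Bool) → ZMod 2) = 0 := by
  funext y
  simp

/-- The carry: `(val a − val b − val(a − b))/2 ∈ {0, −1}` for `a, b ∈ 𝔽₂`. [folklore] -/
private theorem exists_int_carry (a b : ZMod 2) :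
    ∃ z : ℤ, ((a.val : ℝ) - b.val) / 2 - ((a - b).val : ℝ) / 2 = z := by
  have v0 : (0 : ZMod 2).val = 0 := rfl
  have v1 : (1 : ZMod 2).val = 1 := rfl
  rcases zmod_two_cases a with rfl | rfl <;> rcases zmod_two_cases b with rfl | rfl
  · refine ⟨0, ?_⟩
    rw [sub_zero, v0]
    norm_num
  · refine ⟨-1, ?_⟩
    rw [show (0 : ZMod 2) - 1 = 1 from by decide, v0, v1]
    norm_num
  · refine ⟨0, ?_⟩
    rw [sub_zero, v1, v0]
    norm_num
  · refine ⟨0, ?_⟩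
    rw [show (1 : ZMod 2) - 1 = 0 from by decide, v1, v0]
    norm_num

/-- **One real derivative of the lift = the lift of the `𝔽₂`-derivative, modulo a `ℤ`-valued
function.** [cite: BhowmickLovett2015, Def. 2.1 & §1 (classical case)] -/
theorem deriv_halfLift (P : (ι → Bool) → ZMod 2) (h : ι → ZMod 2) :
    ∃ Z : (ι → ZMod 2) → ℝ, IsIntValued Z ∧
      NonclassicalPolynomials.deriv h (halfLift P) = halfLift (derivF (toBoolVec h) P) + Z := by
  refine ⟨NonclassicalPolynomials.deriv h (halfLift P) - halfLift (derivF (toBoolVec h) P),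
    fun y => ?_, by abel⟩
  simp only [Pi.sub_apply, NonclassicalPolynomials.deriv, halfLift_apply, derivF_apply, toBoolVec_add]
  rw [← sub_div]
  exact exists_int_carry _ _

/-- Iterated form: `D_{h₁}⋯D_{h_k}(P/2) = (∂_{h₁}⋯∂_{h_k} P)/2 + ℤ-valued`.
[cite: BhowmickLovett2015, Def. 2.1 & §1 (classical case)] -/
theorem iterDeriv_halfLift :
    ∀ (hs : List (ι → ZMod 2)) (P : (ι → Bool) → ZMod 2),
      ∃ Z : (ι → ZMod 2) → ℝ, IsIntValued Z ∧
        iterDeriv hs (halfLift P) = halfLift (iterDerivF (hs.map toBoolVec) P) + Z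
  | [], P => ⟨0, fun _ => ⟨0, by simp⟩, by simp⟩
  | h :: hs, P => by
      obtain ⟨Z₁, hZ₁, e₁⟩ := deriv_halfLift P h
      obtain ⟨Z₂, hZ₂, e₂⟩ := iterDeriv_halfLift hs (derivF (toBoolVec h) P)
      refine ⟨Z₂ + iterDeriv hs Z₁, hZ₂.add (hZ₁.iterDeriv hs), ?_⟩
      rw [iterDeriv_cons, e₁, iterDeriv_add, e₂, List.map_cons, iterDerivF_cons, add_assoc]

/-- **Classical ⇒ nonclassical**: the half-lift of an `𝔽₂`-polynomial of degree `≤ d` is a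
nonclassical polynomial of degree `≤ d` ("classical polynomials are a special case").
[cite: BhowmickLovett2015, §1 & Def. 2.1; ViolaWigderson2008, §2.1] -/
theorem isNonclassicalPoly_halfLift [Fintype ι] [DecidableEq ι] {d : ℕ}
    {P : (ι → Bool) → ZMod 2} (hP : P ∈ degLE (ZMod 2) ι d) : IsNonclassicalPoly d (halfLift P) := by
  intro hs hlen
  obtain ⟨Z, hZ, e⟩ := iterDeriv_halfLift hs P
  rw [e, iterDerivF_eq_zero d hP (hs.map toBoolVec) (by simpa using hlen), halfLift_zero, zero_add]
  exact hZ

end HalfLift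

/-! ### 4. Viola–Wigderson's Theorem 2.9 for classical polynomials, in GRS normalisation -/

section VW

variable {ι : Type*} [Fintype ι] [DecidableEq ι]

omit [DecidableEq ι] in
/-- `χ_m(a)^w = e(a·w/m)` (`a` read in `{0,…,m−1}`).
[cite: ViolaWigderson2008, §2.3 (e_m(y) = e^{2πiy/m})] -/
theorem stdAddChar_pow_eq_eChar {m : ℕ} [NeZero m] (a : ZMod m) (w : ℕ) :
    (stdAddChar a : ℂ) ^ w = eChar ((a.val : ℝ) * w / m) := by
  rw [stdAddChar_apply, toCircle_apply,
    show ((a.val : ℝ) * w / m : ℝ) = (w : ℝ) * ((a.val : ℝ) / m) by ring, eChar_nat_mul,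
    NonclassicalPolynomials.eChar]
  congr 2
  push_cast
  ring

/-- **Viola–Wigderson, Theorem 2.9 (character form, classical polynomials).**  For `m` odd,
`a ≠ 0` in `ℤ/m` and `P ∈ degLE (ZMod 2) ι d` (an `𝔽₂`-polynomial of degree `≤ d` on `{0,1}^ι`,
`|ι| = n`):
`‖Σ_{x ∈ {0,1}^ι} χ₂(P x)·χ_m(a)^{#x}‖^{2^{d+1}} ≤ (1 − (1 − cos(2π/m))/2^{d+1})ⁿ · (2ⁿ)^{2^{d+1}}`
— the printed `|E_x e_m(aΣx_j) p(x)| ≤ U_{d+1}(e_m^a)^{n/2^{d+1}}`, `U_k(e_m^a) = 1 − (1−δ)/2^k`,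
with `δ ≤ cos(2π/m)`; obtained from the nonclassical form `bhowmickLovett_thm31` through the bridge
`isNonclassicalPoly_halfLift`.
[cite: ViolaWigderson2008, Thm 2.9 (p. 149) and its proof (pp. 149–150); BhowmickLovett2015, Thm 3.1] -/
theorem norm_sum_pow_le_of_mem_degLE {m : ℕ} [NeZero m] (hm : Odd m) {a : ZMod m} (ha : a ≠ 0)
    {d : ℕ} {P : (ι → Bool) → ZMod 2} (hP : P ∈ degLE (ZMod 2) ι d) :
    ‖∑ x : ι → Bool, (stdAddChar (P x) : ℂ) *
        (stdAddChar a : ℂ) ^ (univ.filter fun i => x i = true).card‖ ^ 2 ^ (d + 1)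
      ≤ (1 - (1 - Real.cos (2 * Real.pi / m)) / 2 ^ (d + 1)) ^ Fintype.card ι
          * ((2 : ℝ) ^ Fintype.card ι) ^ 2 ^ (d + 1) := by
  have hna : ¬ m ∣ a.val := fun h =>
    ha ((ZMod.val_eq_zero a).mp (Nat.eq_zero_of_dvd_of_lt h (ZMod.val_lt a)))
  have key := bhowmickLovett_thm31 (ι := ι) hm hna d (isNonclassicalPoly_halfLift hP)
  have hsum : ∑ y : ι → ZMod 2, eChar (halfLift P y) * eChar ((a.val : ℝ) * weight y / m)
      = ∑ x : ι → Bool, (stdAddChar (P x) : ℂ) *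
          (stdAddChar a : ℂ) ^ (univ.filter fun i => x i = true).card := by
    rw [← (boolCubeEquiv (ι := ι)).sum_comp]
    refine sum_congr rfl fun x _ => ?_
    rw [boolCubeEquiv_apply, eChar_halfLift, toBoolVec_ofBoolVec, weight_ofBoolVec,
      stdAddChar_pow_eq_eChar]
  rw [← hsum]
  exact key

/-- `cos(2π/3) = −1/2`. [folklore] -/
private theorem cos_two_pi_div_three : Real.cos (2 * Real.pi / 3) = -1 / 2 := by
  rw [show 2 * Real.pi / 3 = Real.pi - Real.pi / 3 by ring, Real.cos_pi_sub, Real.cos_pi_div_three]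
  norm_num

/-- **The `exp(−Ω(n/4^d))` form** ("`Cor ≤ exp(−α·n/4^d)`"): for `m` odd, `a ≠ 0` in `ℤ/m` and
`P ∈ degLE (ZMod 2) ι d`,
`‖Σ_{x ∈ {0,1}^ι} χ₂(P x)·χ_m(a)^{#x}‖ ≤ 2ⁿ · exp(−(1 − cos(2π/m))·n / 4^{d+1})`
(from `norm_sum_pow_le_of_mem_degLE` by `1 − t ≤ e^{−t}` and a `2^{d+1}`-th root).
[cite: ViolaWigderson2008, Thm 2.9 (p. 149)] -/
theorem norm_sum_le_two_pow_mul_exp {m : ℕ} [NeZero m] (hm : Odd m) {a : ZMod m} (ha : a ≠ 0)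
    {d : ℕ} {P : (ι → Bool) → ZMod 2} (hP : P ∈ degLE (ZMod 2) ι d) :
    ‖∑ x : ι → Bool, (stdAddChar (P x) : ℂ) *
        (stdAddChar a : ℂ) ^ (univ.filter fun i => x i = true).card‖
      ≤ 2 ^ Fintype.card ι *
          Real.exp (-((1 - Real.cos (2 * Real.pi / m)) * Fintype.card ι / 4 ^ (d + 1))) := by
  have h := norm_sum_pow_le_of_mem_degLE hm ha hP
  set X := ‖∑ x : ι → Bool, (stdAddChar (P x) : ℂ) *
        (stdAddChar a : ℂ) ^ (univ.filter fun i => x i = true).card‖ with hX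
  set n := Fintype.card ι with hn
  set δ : ℝ := 1 - Real.cos (2 * Real.pi / m) with hδ
  have hδ2 : δ ≤ 2 := by have := Real.neg_one_le_cos (2 * Real.pi / m); linarith
  have hN2 : (2 : ℝ) ≤ (2 : ℝ) ^ (d + 1) := by
    calc (2 : ℝ) = 2 ^ 1 := (pow_one _).symm
      _ ≤ 2 ^ (d + 1) := pow_le_pow_right₀ one_le_two (by omega)
  have hρ0 : 0 ≤ 1 - δ / (2 : ℝ) ^ (d + 1) := by
    rw [sub_nonneg, div_le_one (by positivity)]
    linarith
  have hρexp : 1 - δ / (2 : ℝ) ^ (d + 1) ≤ Real.exp (-(δ / 2 ^ (d + 1))) := by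
    have := Real.add_one_le_exp (-(δ / 2 ^ (d + 1)))
    linarith
  have hρn : (1 - δ / (2 : ℝ) ^ (d + 1)) ^ n
      ≤ Real.exp (-(δ * n / 4 ^ (d + 1))) ^ 2 ^ (d + 1) := by
    calc (1 - δ / (2 : ℝ) ^ (d + 1)) ^ n ≤ Real.exp (-(δ / 2 ^ (d + 1))) ^ n :=
          pow_le_pow_left₀ hρ0 hρexp n
      _ = Real.exp (-(δ * n / 4 ^ (d + 1))) ^ 2 ^ (d + 1) := by
          rw [← Real.exp_nat_mul, ← Real.exp_nat_mul]
          congr 1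
          have h4 : (4 : ℝ) ^ (d + 1) = 2 ^ (d + 1) * 2 ^ (d + 1) := by
            rw [← mul_pow]
            norm_num
          rw [h4]
          push_cast
          field_simp
  have hXN : X ^ 2 ^ (d + 1) ≤ (Real.exp (-(δ * n / 4 ^ (d + 1))) * 2 ^ n) ^ 2 ^ (d + 1) := by
    calc X ^ 2 ^ (d + 1) ≤ (1 - δ / (2 : ℝ) ^ (d + 1)) ^ n * ((2 : ℝ) ^ n) ^ 2 ^ (d + 1) := h
      _ ≤ Real.exp (-(δ * n / 4 ^ (d + 1))) ^ 2 ^ (d + 1) * ((2 : ℝ) ^ n) ^ 2 ^ (d + 1) :=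
          mul_le_mul_of_nonneg_right hρn (by positivity)
      _ = (Real.exp (-(δ * n / 4 ^ (d + 1))) * 2 ^ n) ^ 2 ^ (d + 1) := by rw [mul_pow]
  have hle := le_of_pow_le_pow_left₀ (pow_ne_zero _ two_ne_zero) (by positivity) hXN
  rw [mul_comm]
  exact hle

/-- **The case `m = 3`** (`1 − cos(2π/3) = 3/2`): for `a ≠ 0` in `ℤ/3` and `P ∈ degLE (ZMod 2) ι d`,
`‖Σ_{x ∈ {0,1}^ι} χ₂(P x)·χ₃(a)^{#x}‖ ≤ 2ⁿ · exp(−3n/(8·4^d))`.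
[cite: ViolaWigderson2008, Thm 2.9 (p. 149)] -/
theorem norm_sum_le_two_pow_mul_exp_three {a : ZMod 3} (ha : a ≠ 0)
    {d : ℕ} {P : (ι → Bool) → ZMod 2} (hP : P ∈ degLE (ZMod 2) ι d) :
    ‖∑ x : ι → Bool, (stdAddChar (P x) : ℂ) *
        (stdAddChar a : ℂ) ^ (univ.filter fun i => x i = true).card‖
      ≤ 2 ^ Fintype.card ι * Real.exp (-(3 * Fintype.card ι / (8 * 4 ^ d))) := by
  have h := norm_sum_le_two_pow_mul_exp (m := 3) ⟨1, by norm_num⟩ ha hP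
  have harg : -((1 - Real.cos (2 * Real.pi / (3 : ℕ))) * Fintype.card ι / 4 ^ (d + 1))
      = -(3 * (Fintype.card ι : ℝ) / (8 * 4 ^ d)) := by
    rw [Nat.cast_ofNat, cos_two_pi_div_three, pow_succ]
    ring
  rwa [harg] at h

end VW

/-! ### 5. Restriction, juntas, and an arbitrary linear form modulo `3` -/

section LinearForm

variable {ι : Type*} [Fintype ι] [DecidableEq ι]

omit [Fintype ι] in
/-- A monomial under the substitution `u = (w on I, v off I)`:
`x_S(u) = x_{S ∖ I}(0, v) · x_{S ∩ I}(w)`. [cite: GreenRoyStraubing2005, §2 (the projections v, w)] -/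
theorem cubeMono_glue {R : Type*} [CommRing R] (I S : Finset ι) (w : {i // i ∈ I} → Bool)
    (v : {i // i ∉ I} → Bool) :
    cubeMono R S (glue I w v)
      = cubeMono R (S.filter fun i => i ∉ I) (glue I (fun _ => false) v)
          * cubeMono R (S.subtype fun i => i ∈ I) w := by
  unfold cubeMono
  rw [← prod_filter_mul_prod_filter_not S (fun i => i ∈ I), mul_comm]
  congr 1
  · refine prod_congr rfl fun i hi => ?_
    have h : i ∉ I := (mem_filter.mp hi).2
    simp only [glue_apply_not_mem _ _ h]
  · let f : ι → R := fun i => if h : i ∈ I then (if w ⟨i, h⟩ then 1 else 0) else 1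
    have hsub : ∏ k ∈ S.subtype (fun i => i ∈ I), (if w k then (1 : R) else 0)
        = ∏ k ∈ S.subtype (fun i => i ∈ I), f k.1 := by
      refine prod_congr rfl fun k _ => ?_
      simp only [f, dif_pos k.2]
    rw [hsub, prod_subtype_eq_prod_filter]
    refine prod_congr rfl fun i hi => ?_
    have h : i ∈ I := (mem_filter.mp hi).2
    simp only [f, dif_pos h, glue_apply_mem _ _ h]

/-- **Restriction to a sub-cube preserves degree**: for `P ∈ degLE R ι d`, every `I` and every
assignment `v` off `I`, `w ↦ P(w, v)` lies in `degLE R I d`.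
[cite: GreenRoyStraubing2005, §2 (p(x ⊕ u) "as a polynomial in the wᵢ")] -/
theorem restrict_mem_degLE {R : Type*} [CommRing R] {d : ℕ} {P : (ι → Bool) → R}
    (hP : P ∈ degLE R ι d) (I : Finset ι) (v : {i // i ∉ I} → Bool) :
    (fun w : {i // i ∈ I} → Bool => P (glue I w v)) ∈ degLE R {i // i ∈ I} d := by
  obtain ⟨c, rfl⟩ := mem_degLE_iff.mp hP
  have hfun : (fun w : {i // i ∈ I} → Bool => (∑ S, c S • cubeMono R S.1) (glue I w v))
      = ∑ S : {S : Finset ι // S.card ≤ d},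
          (c S * cubeMono R (S.1.filter fun i => i ∉ I) (glue I (fun _ => false) v))
            • cubeMono R (S.1.subtype fun i => i ∈ I) := by
    funext w
    simp only [Finset.sum_apply, Pi.smul_apply, smul_eq_mul]
    refine sum_congr rfl fun S _ => ?_
    rw [cubeMono_glue, mul_assoc]
  rw [hfun]
  refine Submodule.sum_mem _ fun S _ => Submodule.smul_mem _ _ (cubeMono_mem_degLE ?_)
  rw [card_subtype]
  exact (card_filter_le _ _).trans S.2

/-- **Juntas have degree at most their arity**: an `𝔽₂`-valued function on `{0,1}^ι` depending
only on the coordinates in `T` lies in `degLE (ZMod 2) ι |T|` (it is a combination of the pattern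
indicators `Π_{i ∈ T}[x_i = a_i] = x_T(x ⊕ ¬a)`).
[cite: ViolaWigderson2008, §2 (polynomials of degree d over GF(2) as functions on {0,1}ⁿ)] -/
theorem mem_degLE_card_of_forall_eq (T : Finset ι) {f : (ι → Bool) → ZMod 2}
    (hf : ∀ x y : ι → Bool, (∀ i ∈ T, x i = y i) → f x = f y) : f ∈ degLE (ZMod 2) ι T.card := by
  classical
  -- representatives: zero outside `T`
  let rep : (ι → Bool) → (ι → Bool) := fun x i => if i ∈ T then x i else false
  -- pattern indicators as shifted monomials
  let ind : (ι → Bool) → (ι → Bool) → ZMod 2 :=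
    fun a x => cubeMono (ZMod 2) T (xorVec x fun i => !a i)
  have hind : ∀ a x, ind a x = if (∀ i ∈ T, x i = a i) then 1 else 0 := by
    intro a x
    simp only [ind, cubeMono_apply, xorVec_apply]
    have hiff : (∀ i ∈ T, xor (x i) (!a i) = true) ↔ ∀ i ∈ T, x i = a i := by
      refine forall₂_congr fun i _ => ?_
      cases x i <;> cases a i <;> decide
    simp only [hiff]
  have hrep_agree : ∀ x, ∀ i ∈ T, x i = rep x i := fun x i hi => by simp [rep, hi]
  have hfilter : ∀ x, (univ.image rep).filter (fun a => ∀ i ∈ T, x i = a i) = {rep x} := by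
    intro x
    ext a
    simp only [mem_filter, mem_image, mem_univ, true_and, mem_singleton]
    constructor
    · rintro ⟨⟨x', rfl⟩, h⟩
      funext i
      by_cases hi : i ∈ T
      · have := h i hi
        simp only [rep, if_pos hi] at this ⊢
        exact this.symm
      · simp [rep, hi]
    · rintro rfl
      exact ⟨⟨x, rfl⟩, hrep_agree x⟩
  have hf_eq : f = ∑ a ∈ univ.image rep, f a • ind a := by
    funext x
    simp only [Finset.sum_apply, Pi.smul_apply, smul_eq_mul, hind, mul_ite, mul_one, mul_zero]
    rw [← sum_filter, hfilter x, sum_singleton]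
    exact hf x (rep x) (hrep_agree x)
  rw [hf_eq]
  refine Submodule.sum_mem _ fun a _ => Submodule.smul_mem _ _ ?_
  exact comp_xorVec_mem_degLE (cubeMono_mem_degLE le_rfl) _

/-- Sums of juntas: if each `f_k` depends only on a set `T_k` of at most `w` coordinates, then
`Σ_k f_k ∈ degLE (ZMod 2) ι w` (a parity of `w`-local conditions is a degree-`≤ w` polynomial).
[cite: ViolaWigderson2008, §2] -/
theorem sum_mem_degLE_of_forall_eq {κ : Type*} (s : Finset κ) {w : ℕ} (T : κ → Finset ι)
    (hT : ∀ k ∈ s, (T k).card ≤ w) {f : κ → (ι → Bool) → ZMod 2}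
    (hf : ∀ k ∈ s, ∀ x y : ι → Bool, (∀ i ∈ T k, x i = y i) → f k x = f k y) :
    (∑ k ∈ s, f k) ∈ degLE (ZMod 2) ι w :=
  Submodule.sum_mem _ fun k hk => degLE_mono (hT k hk) (mem_degLE_card_of_forall_eq (T k) (hf k hk))

/-- One coordinate of a linear form modulo `3` after flipping the coordinates with coefficient `2`:
`[x_i ⊕ u_i]·γ_i = c_i + [x_i]·γ'_i` with `u_i = [γ_i = 2]`, `c_i = 2[γ_i = 2]`, `γ'_i = [γ_i ≠ 0]`.
[folklore] -/
private theorem flip_coord (g : ZMod 3) (b : Bool) :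
    (if xor b (decide (g = 2)) then g else 0)
      = (if g = 2 then (2 : ZMod 3) else 0) + (if b then (if g = 0 then 0 else 1) else 0) := by
  revert g b
  decide

/-- A `0/1`-coefficient linear form is a subset count: `Σ_i [x_i]·[i ∈ S] = #{i ∈ S : x_i}` in `ℤ/3`.
[folklore] -/
private theorem sum_ite_ite_eq_card (S : Finset ι) (x : ι → Bool) :
    (∑ i, if x i then (if i ∈ S then (1 : ZMod 3) else 0) else 0)
      = ((S.filter fun i => x i = true).card : ZMod 3) := by
  rw [Finset.card_filter, Nat.cast_sum, ← Finset.sum_filter_add_sum_filter_not univ (fun i => i ∈ S)]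
  have h1 : ∑ i ∈ univ.filter (fun i => i ∈ S), (if x i then (if i ∈ S then (1 : ZMod 3) else 0) else 0)
      = ∑ i ∈ S, ((if x i = true then 1 else 0 : ℕ) : ZMod 3) := by
    rw [filter_mem_eq_inter, univ_inter]
    refine sum_congr rfl fun i hi => ?_
    simp [hi]
  have h2 : ∑ i ∈ univ.filter (fun i => ¬ i ∈ S),
      (if x i then (if i ∈ S then (1 : ZMod 3) else 0) else 0) = 0 := by
    refine sum_eq_zero fun i hi => ?_
    have h : i ∉ S := (mem_filter.mp hi).2
    simp [h]
  rw [h1, h2, add_zero]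

/-- **Arbitrary linear form modulo `3`** (the leaf estimate for radius-`w₀` clusters of the
advice-free-`QNC⁰` descent): for `P ∈ degLE (ZMod 2) ι d` and every `γ : ι → ℤ/3`,
`‖Σ_{x ∈ {0,1}^ι} χ₂(P x)·χ₃(Σ_i γ_i x_i)‖ ≤ 2ⁿ · exp(−3·wt(γ)/(8·4^d))`, `wt(γ) = #{i : γ_i ≠ 0}`.
Proof: flip the coordinates with `γ_i = 2` (`comp_xorVec_mem_degLE`; the form becomes a constant
plus `#{i ∈ supp γ : x_i}`), fibre over the coordinates off `supp γ` (`restrict_mem_degLE`) and apply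
`norm_sum_le_two_pow_mul_exp_three` on each fibre `{0,1}^{supp γ}`.
[cite: ViolaWigderson2008, Thm 2.9 (p. 149); GreenRoyStraubing2005, §2] -/
theorem norm_sum_mul_stdAddChar_linear_le {d : ℕ} {P : (ι → Bool) → ZMod 2}
    (hP : P ∈ degLE (ZMod 2) ι d) (γ : ι → ZMod 3) :
    ‖∑ x : ι → Bool, (stdAddChar (P x) : ℂ) * stdAddChar (∑ i, if x i then γ i else 0)‖
      ≤ 2 ^ Fintype.card ι *
          Real.exp (-(3 * ((univ.filter fun i => γ i ≠ 0).card : ℝ) / (8 * 4 ^ d))) := by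
  classical
  set S : Finset ι := univ.filter fun i => γ i ≠ 0 with hS
  let u : ι → Bool := fun i => decide (γ i = 2)
  let C : ZMod 3 := ∑ i, if γ i = 2 then (2 : ZMod 3) else 0
  let P' : (ι → Bool) → ZMod 2 := fun y => P (xorVec y u)
  have hP' : P' ∈ degLE (ZMod 2) ι d := comp_xorVec_mem_degLE hP u
  -- Step A: flip the coordinates with `γ_i = 2`
  have hflip : ∀ y : ι → Bool, (∑ i, if xorVec y u i then γ i else 0)
      = C + ((S.filter fun i => y i = true).card : ZMod 3) := by
    intro y
    rw [← sum_ite_ite_eq_card, ← sum_add_distrib]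
    refine sum_congr rfl fun i _ => ?_
    rw [xorVec_apply, flip_coord (γ i) (y i)]
    simp only [hS, mem_filter, mem_univ, true_and]
    by_cases h0 : γ i = 0 <;> simp [h0]
  have hA : ∑ x : ι → Bool, (stdAddChar (P x) : ℂ) * stdAddChar (∑ i, if x i then γ i else 0)
      = stdAddChar C * ∑ y : ι → Bool, (stdAddChar (P' y) : ℂ) *
          (stdAddChar (1 : ZMod 3) : ℂ) ^ (S.filter fun i => y i = true).card := by
    rw [← (shiftEquiv u).sum_comp, mul_sum]
    refine sum_congr rfl fun y _ => ?_
    rw [shiftEquiv_apply, hflip y, AddChar.map_add_eq_mul, ← nsmul_one ((S.filter _).card),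
      AddChar.map_nsmul_eq_pow]
    ring
  -- Step B: fibre over the coordinates off `S`
  have hB : ∑ y : ι → Bool, (stdAddChar (P' y) : ℂ) *
        (stdAddChar (1 : ZMod 3) : ℂ) ^ (S.filter fun i => y i = true).card
      = ∑ v : {i // i ∉ S} → Bool, ∑ w : {i // i ∈ S} → Bool,
          (stdAddChar (P' (glue S w v)) : ℂ) *
            (stdAddChar (1 : ZMod 3) : ℂ) ^ (univ.filter fun k : {i // i ∈ S} => w k = true).card := by
    rw [sum_eq_sum_sum_glue S]
    refine sum_congr rfl fun v _ => sum_congr rfl fun w _ => ?_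
    rw [card_filter_glue_eq]
  -- Step C: the bound on each fibre
  have hfib : ∀ v : {i // i ∉ S} → Bool,
      ‖∑ w : {i // i ∈ S} → Bool, (stdAddChar (P' (glue S w v)) : ℂ) *
          (stdAddChar (1 : ZMod 3) : ℂ) ^ (univ.filter fun k : {i // i ∈ S} => w k = true).card‖
        ≤ 2 ^ S.card * Real.exp (-(3 * (S.card : ℝ) / (8 * 4 ^ d))) := by
    intro v
    have h := norm_sum_le_two_pow_mul_exp_three (ι := {i // i ∈ S}) (a := (1 : ZMod 3)) (by decide)
      (restrict_mem_degLE hP' S v)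
    simpa only [Fintype.card_coe] using h
  -- assemble
  have hC : ‖(stdAddChar C : ℂ)‖ = 1 := by
    rw [stdAddChar_apply]
    exact Circle.norm_coe _
  have hcardv : (Fintype.card ({i // i ∉ S} → Bool) : ℝ) = 2 ^ (Fintype.card ι - S.card) := by
    rw [Fintype.card_fun, Fintype.card_bool, Fintype.card_subtype_compl, Fintype.card_coe]
    push_cast
    ring
  have hSle : S.card ≤ Fintype.card ι := card_le_univ S
  rw [hA, norm_mul, hC, one_mul, hB]
  calc ‖∑ v : {i // i ∉ S} → Bool, ∑ w : {i // i ∈ S} → Bool,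
          (stdAddChar (P' (glue S w v)) : ℂ) *
            (stdAddChar (1 : ZMod 3) : ℂ) ^ (univ.filter fun k : {i // i ∈ S} => w k = true).card‖
      ≤ ∑ v : {i // i ∉ S} → Bool, ‖∑ w : {i // i ∈ S} → Bool,
          (stdAddChar (P' (glue S w v)) : ℂ) *
            (stdAddChar (1 : ZMod 3) : ℂ) ^ (univ.filter fun k : {i // i ∈ S} => w k = true).card‖ :=
        norm_sum_le _ _
    _ ≤ ∑ _v : {i // i ∉ S} → Bool, 2 ^ S.card * Real.exp (-(3 * (S.card : ℝ) / (8 * 4 ^ d))) :=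
        sum_le_sum fun v _ => hfib v
    _ = 2 ^ Fintype.card ι * Real.exp (-(3 * (S.card : ℝ) / (8 * 4 ^ d))) := by
        rw [sum_const, card_univ, nsmul_eq_mul, hcardv, ← mul_assoc, ← pow_add,
          Nat.sub_add_cancel hSle]

end LinearForm

/-! ### 6. The same estimates in the `ω^k · (−1)^g` shape (cube `Fin n → Bool`, `Smolensky.lowDeg`),
and the sharp linear case (character versus a product of signs) -/

section CellShape

variable {ι : Type*} [Fintype ι] [DecidableEq ι]

omit [Fintype ι] [DecidableEq ι] in
/-- `ω^k = χ₃(k mod 3)` for `ω = e^{2πi/3}`. [cite: ViolaWigderson2008, §2.3 (e_m(y) = e^{2πiy/m})] -/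
theorem cexp_two_pi_I_div_three_pow (k : ℕ) :
    Complex.exp (2 * Real.pi * Complex.I / 3) ^ k = (stdAddChar (k : ZMod 3) : ℂ) := by
  rw [← Complex.exp_nat_mul, stdAddChar_apply, toCircle_natCast]
  congr 1
  push_cast
  ring

omit [DecidableEq ι] in
/-- The phase `ω^{Σ_{i : x_i} a_i}` (exponent read in `ℕ` through `ZMod.val`) is the character value
`χ₃(Σ_{i : x_i} a_i)`. [cite: ViolaWigderson2008, §2.3 (e_m(Σ_j x_j))] -/
theorem cexp_pow_sum_val_eq_stdAddChar (a : ι → ZMod 3) (x : ι → Bool) :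
    Complex.exp (2 * Real.pi * Complex.I / 3) ^ (∑ i, if x i then (a i).val else 0)
      = (stdAddChar (∑ i, if x i then a i else 0) : ℂ) := by
  rw [cexp_two_pi_I_div_three_pow]
  congr 1
  rw [Nat.cast_sum]
  refine sum_congr rfl fun i _ => ?_
  split_ifs <;> simp

omit [Fintype ι] [DecidableEq ι] in
/-- `χ₂(1) = −1`. [folklore] -/
private theorem stdAddChar_one_zmod_two : (stdAddChar (1 : ZMod 2) : ℂ) = -1 := by
  rw [show (1 : ZMod 2) = ((1 : ℕ) : ZMod 2) from rfl, stdAddChar_apply, toCircle_natCast,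
    ← Complex.exp_pi_mul_I]
  congr 1
  push_cast
  ring

omit [Fintype ι] [DecidableEq ι] in
/-- The sign `(−1)^{t}` of `t ∈ 𝔽₂` is the character value `χ₂(t)`.
[cite: ViolaWigderson2008, §2 ("(−1)^{p(x)}")] -/
theorem ite_eq_one_eq_stdAddChar (t : ZMod 2) :
    (if t = 1 then (-1 : ℂ) else 1) = (stdAddChar t : ℂ) := by
  obtain h | h : t = 0 ∨ t = 1 := by revert t; decide
  · rw [h, if_neg (by decide), AddChar.map_zero_eq_one]
  · rw [h, if_pos rfl, stdAddChar_one_zmod_two]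

/-- **`MOD₃` characters versus low `𝔽₂`-degree, cell shape** (`ι = Fin n`, `g ∈ Smolensky.lowDeg`,
phase `ω^{Σ a_i x_i}`, sign `(−1)^{g}`): for every `a : Fin n → ℤ/3` and `g` of degree `≤ d`,
`‖Σ_x ω^{Σ_{i : x_i} a_i} (−1)^{g(x)}‖ ≤ 2ⁿ · exp(−3·wt(a)/(8·4^d))`.
This is `norm_sum_mul_stdAddChar_linear_le` rewritten. [cite: ViolaWigderson2008, Thm 2.9 (p. 149)] -/
theorem norm_sum_cexp_pow_mul_sign_le {d n : ℕ} (a : Fin n → ZMod 3)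
    {g : Smolensky.CubeFn (ZMod 2) n} (hg : g ∈ Smolensky.lowDeg (ZMod 2) n d) :
    ‖∑ x : Fin n → Bool, Complex.exp (2 * Real.pi * Complex.I / 3) ^ (∑ i, if x i then (a i).val else 0) *
        (if g x = 1 then (-1 : ℂ) else 1)‖
      ≤ (2 : ℝ) ^ n * Real.exp (-(3 * ((univ.filter fun i => a i ≠ 0).card : ℝ) / (8 * 4 ^ d))) := by
  rw [smolensky_lowDeg_eq_degLE] at hg
  have h := norm_sum_mul_stdAddChar_linear_le hg a
  rw [Fintype.card_fin] at h
  convert h using 3 with x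
  rw [cexp_pow_sum_val_eq_stdAddChar, ite_eq_one_eq_stdAddChar, mul_comm]

/-- Full support: if every coefficient `a_i` is nonzero the exponent is `−3n/(8·4^d)`.
[cite: ViolaWigderson2008, Thm 2.9 (p. 149)] -/
theorem norm_sum_cexp_pow_mul_sign_le_of_forall_ne_zero {d n : ℕ} {a : Fin n → ZMod 3}
    (ha : ∀ i, a i ≠ 0) {g : Smolensky.CubeFn (ZMod 2) n} (hg : g ∈ Smolensky.lowDeg (ZMod 2) n d) :
    ‖∑ x : Fin n → Bool, Complex.exp (2 * Real.pi * Complex.I / 3) ^ (∑ i, if x i then (a i).val else 0) *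
        (if g x = 1 then (-1 : ℂ) else 1)‖
      ≤ (2 : ℝ) ^ n * Real.exp (-(3 / (8 * 4 ^ d) * n)) := by
  have h := norm_sum_cexp_pow_mul_sign_le a hg
  have hcard : (univ.filter fun i => a i ≠ 0).card = n := by
    rw [filter_true_of_mem fun i _ => ha i, card_univ, Fintype.card_fin]
  rw [hcard] at h
  convert h using 3
  ring

/-- **`Mod3VsLowDegree`** — the statement in the `∀ d ∃ c > 0 ∃ n₀ ∀ n ≥ n₀` packaging used by the
advice-free-`QNC⁰` cell (frame averaging, general junta width), with the explicit witnesses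
`c = 3/(8·4^d)`, `n₀ = 0`: a nontrivial `MOD₃` character of full support has exponentially small
correlation with `(−1)^g`, `deg_{𝔽₂} g ≤ d`. [cite: ViolaWigderson2008, Thm 2.9 (p. 149)] -/
theorem mod3VsLowDegree :
    ∀ d : ℕ, ∃ c : ℝ, 0 < c ∧ ∃ n₀ : ℕ, ∀ n ≥ n₀, ∀ (a : Fin n → ZMod 3) (g : Smolensky.CubeFn (ZMod 2) n),
      (∀ i, a i ≠ 0) → g ∈ Smolensky.lowDeg (ZMod 2) n d →
        ‖∑ x : Fin n → Bool, Complex.exp (2 * Real.pi * Complex.I / 3) ^ (∑ i, if x i then (a i).val else 0) *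
            (if g x = 1 then (-1 : ℂ) else 1)‖ ≤ (2 : ℝ) ^ n * Real.exp (-(c * n)) :=
  fun d => ⟨3 / (8 * 4 ^ d), by positivity, 0, fun _ _ _ g ha hg =>
    norm_sum_cexp_pow_mul_sign_le_of_forall_ne_zero ha hg⟩

/-- **Character versus a product of signs** (the linear case `d = 1` with the SHARP per-coordinate
constant): for `γ : ι → ℤ/3` and signs `s : ι → {±1}`,
`‖Σ_{F ∈ {0,1}^ι} χ₃(Σ_{i : F_i} γ_i) · ∏_{i : F_i} s_i‖ = ∏_i ‖1 + s_i χ₃(γ_i)‖ ≤ 2^{|ι|} (√3/2)^{wt γ}`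
(`‖1 ± χ₃(γ)‖ ≤ 2cos(π/6) = √3` for `γ ≠ 0`: two coprime moduli `3, 2`).  The sum factorises over
the coordinates exactly as in the case `d = 1` of [GreenRoyStraubing2005, §2] / Bourgain's (10).
[cite: GreenRoyStraubing2005, §2 (case d = 1); Bourgain2005ExpSums, §2 eq. (10)] -/
theorem norm_sum_stdAddChar_linear_mul_prod_sign_le (γ : ι → ZMod 3) (s : ι → Bool) :
    ‖∑ F : ι → Bool, (stdAddChar (∑ i, if F i then γ i else 0) : ℂ) *
        ∏ i, (if F i ∧ s i then (-1 : ℂ) else 1)‖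
      ≤ 2 ^ Fintype.card ι * (Real.sqrt 3 / 2) ^ (univ.filter fun i => γ i ≠ 0).card := by
  -- factorise over the coordinates
  let c : ι → ℂ := fun i => if s i then -1 else 1
  have hterm : ∀ F : ι → Bool, (stdAddChar (∑ i, if F i then γ i else 0) : ℂ) *
      ∏ i, (if F i ∧ s i then (-1 : ℂ) else 1)
      = ∏ i, (fun (i : ι) (b : Bool) => if b then (stdAddChar (γ i) : ℂ) * c i else 1) i (F i) := by
    intro F
    rw [stdAddChar_sum_ite, ← prod_mul_distrib]
    refine prod_congr rfl fun i _ => ?_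
    by_cases hF : F i = true <;> by_cases hs : s i = true <;> simp [c, hF, hs]
  simp_rw [hterm]
  rw [sum_bool_fun_prod (fun (i : ι) (b : Bool) => if b then (stdAddChar (γ i) : ℂ) * c i else 1),
    Complex.norm_prod]
  simp only [Bool.false_eq_true, if_false, if_true]
  -- one coordinate: `‖1 + χ₃(γ)χ₂(t)‖ ≤ 2cos(π/6) = √3` for `γ ≠ 0`
  have h32 : (3 : ℕ).Coprime 2 := by decide
  have hcos : 2 * Real.cos (Real.pi / ((3 : ℕ) * (2 : ℕ) : ℝ)) = 2 * (Real.sqrt 3 / 2) := by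
    have e : (Real.pi / ((3 : ℕ) * (2 : ℕ) : ℝ)) = Real.pi / 6 := by push_cast; ring
    rw [e, Real.cos_pi_div_six]
  have hfac : ∀ i, ‖(1 : ℂ) + stdAddChar (γ i) * c i‖
      ≤ 2 * (if γ i ≠ 0 then Real.sqrt 3 / 2 else 1) := by
    intro i
    obtain ⟨t, ht⟩ : ∃ t : ZMod 2, c i = stdAddChar t := by
      by_cases hs : s i = true
      · exact ⟨1, by simp [c, hs, stdAddChar_one_zmod_two]⟩
      · exact ⟨0, by simp [c, hs]⟩
    rw [ht]
    split_ifs with hi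
    · rw [← hcos]
      exact norm_one_add_stdAddChar_mul_stdAddChar_le h32 hi t
    · calc ‖(1 : ℂ) + stdAddChar (γ i) * stdAddChar t‖
          ≤ ‖(1 : ℂ)‖ + ‖(stdAddChar (γ i) : ℂ) * stdAddChar t‖ := norm_add_le _ _
        _ = 2 * 1 := by
            rw [norm_mul, stdAddChar_apply, Circle.norm_coe, stdAddChar_apply, Circle.norm_coe]
            norm_num
  calc ∏ i, ‖(1 : ℂ) + stdAddChar (γ i) * c i‖
      ≤ ∏ i, 2 * (if γ i ≠ 0 then Real.sqrt 3 / 2 else (1 : ℝ)) :=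
        prod_le_prod (fun i _ => norm_nonneg _) fun i _ => hfac i
    _ = 2 ^ Fintype.card ι * (Real.sqrt 3 / 2) ^ (univ.filter fun i => γ i ≠ 0).card := by
        rw [prod_mul_distrib, prod_const, card_univ, prod_ite, prod_const_one, mul_one, prod_const]

/-- **`CharVsProduct`, cell shape** (`ι = Fin q`, phase `ω^{Σ γ_p F_p}` with the exponent read in `ℕ`):
`‖Σ_F ω^{⟨γ,F⟩} ∏_p s_p^{F_p}‖ ≤ 2^q (√3/2)^{wt γ}`.
[cite: GreenRoyStraubing2005, §2 (case d = 1); Bourgain2005ExpSums, §2 eq. (10)] -/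
theorem charVsProduct (q : ℕ) (γ : Fin q → ZMod 3) (s : Fin q → Bool) :
    ‖∑ F : Fin q → Bool, Complex.exp (2 * Real.pi * Complex.I / 3) ^ (∑ p, if F p then (γ p).val else 0) *
        (∏ p, if F p ∧ s p then (-1 : ℂ) else 1)‖
      ≤ (2 : ℝ) ^ q * (Real.sqrt 3 / 2) ^ (univ.filter fun p => γ p ≠ 0).card := by
  have h := norm_sum_stdAddChar_linear_mul_prod_sign_le γ s
  rw [Fintype.card_fin] at h
  convert h using 3 with F
  rw [cexp_pow_sum_val_eq_stdAddChar]

end CellShape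

end TwoModuli

end Literature.Computability.MetaComplexity
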